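import Literature.NumberTheory.Automorphic.HidaLevelOrdinaryRestriction
import Literature.NumberTheory.Automorphic.HidaLevelHeckeEquivariance
import Literature.NumberTheory.Automorphic.HidaTowerCoefficientSequences
import Literature.NumberTheory.Automorphic.HidaTowerDegreeZeroNilpotent
import Literature.NumberTheory.Automorphic.LevelControlFiniteLevelSplit
import Literature.NumberTheory.Automorphic.GlobalScalarApproximation
import Literature.NumberTheory.Automorphic.LevelActionTopVanishing
import HarnessLib

/-!
# Transport of annihilators down the Hida tower, I: degree one

Topic `NumberTheory/Automorphic`; namespace `Literature.NumberTheory.Automorphic.BigHeckeGLn.TameLevel`;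
theorems only (no new definitions, no named fact, no `sorry`).

`GL₂` over a number field `K`, tame level `U` maximal above `p`, trivial coefficients `ℤ/p^s`,
levels `U(b, c)`; `LaKills b c s i z` says that the polynomial `z ∈ ℤ[T]` in the Hida elements
kills the ordinary part `laOrd` of `H^i(U(b,c), ℤ/p^s)`.  GIVEN the Borel–Serre finiteness `hX`:

* `exists_transversal_level`, `relIndex_level_ne_zero`, `level_inf_level`, `relIndex_level_le` —
  transversals and indices of the levels `U(b,c)` (all bounded by `[U(0,1) : U(R,R)]`);
* `laHecke_pow_apply_eq_zero_of_resCohomology_eq_zero` — **`ker (res : H¹(U(r,c)) → H¹(U(c,c)))`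
  is killed by `U_{v,1}^m`** (`m ≥ s`): the flat-free finite-level control
  `ker_resCohomology_le_ker_pow_heckeCohomology` for `U(c,c) ⊴ U(r,c)` with the unipotent adapted
  family, whose input `U^m = 0` on `H⁰(𝓕 C)` is `inducedHeckeCohomology_zero_pow_eq_zero_triv`;
* **`laKills_tower_one`** — `LaKills c c c 1 z → LaKills r (max r 1) s 1 z` (`r, s ≤ c`): transport
  along `res : H¹(U(r,c)) → H¹(U(c,c))` (injective on `laOrd` by the previous point), along
  `res : H¹(U(r, max r 1)) → H¹(U(r,c))` (Hida's lemma `injOn_resCohomology_laOrd`) and along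
  `(× p^{c-s})_* : H¹(ℤ/p^s) → H¹(ℤ/p^c)` (`laKills_of_mul`).

[cite: Hida1994AIF, §3, Thm 3.2 and its proof] [cite: KhareThorne2017, §6.3, Prop. 6.6, Lemma 6.10]

## References

* H. Hida, Ann. Inst. Fourier 44 (1994), §2–3. [Hida1994AIF]
* C. Khare, J. A. Thorne, Amer. J. Math. 139 (2017), §6.3. [KhareThorne2017]
-/

noncomputable section

open CategoryTheory IsDedekindDomain
open scoped NumberField

namespace Literature.NumberTheory.Automorphic

/-! ### Transversals from finiteness -/

namespace ArithmeticQuotient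

variable {𝒢 : Type} [Group 𝒢] {L L' : Subgroup 𝒢}

/-- A finite `L 1 L' / L'` has a transversal (`Quotient.out` representatives). [folklore] -/
theorem exists_finset_bijOn_of_finite (hfin : (doubleCosetQuot₂ L L' (1 : 𝒢)).Finite) :
    ∃ S : Finset 𝒢, Set.BijOn (fun s : 𝒢 => (s : 𝒢 ⧸ L')) S (doubleCosetQuot₂ L L' 1) := by
  classical
  refine ⟨hfin.toFinset.image Quotient.out, ?_, ?_, ?_⟩
  · rintro _ hs
    obtain ⟨d, hd, rfl⟩ := Finset.mem_image.1 (Finset.mem_coe.1 hs)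
    simp only [QuotientGroup.out_eq']
    exact hfin.mem_toFinset.1 hd
  · rintro _ hs₁ _ hs₂ h
    obtain ⟨d₁, -, rfl⟩ := Finset.mem_image.1 (Finset.mem_coe.1 hs₁)
    obtain ⟨d₂, -, rfl⟩ := Finset.mem_image.1 (Finset.mem_coe.1 hs₂)
    simp only [QuotientGroup.out_eq'] at h
    rw [h]
  · intro d hd
    exact ⟨d.out, Finset.mem_coe.2 (Finset.mem_image_of_mem _ (hfin.mem_toFinset.2 hd)), QuotientGroup.out_eq' d⟩

end ArithmeticQuotient

namespace BigHeckeGLn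

/-! ### Intersections of Iwahori levels -/

section Iwahori

variable {K : Type} [Field K] [NumberField K]

/-- `Iw_v(b,c) ⊓ Iw_v(b',c') ≤ Iw_v(max b b', max c c')`. [folklore] -/
theorem mem_iwahoriLevel_max (v : HeightOneSpectrum (𝓞 K)) {n : ℕ} {b c b' c' : ℕ}
    {g : GL (Fin n) (v.adicCompletion K)} (h : g ∈ iwahoriLevel n v b c) (h' : g ∈ iwahoriLevel n v b' c') :
    g ∈ iwahoriLevel n v (max b b') (max c c') := by
  have hmin : ∀ a a' : ℕ, (WithZero.exp (-((max a a' : ℕ) : ℤ)) : WithZero (Multiplicative ℤ)) =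
      min (WithZero.exp (-(a : ℤ))) (WithZero.exp (-(a' : ℤ))) := fun a a' => by
    rcases le_total a a' with h | h
    · rw [max_eq_right h, min_eq_right (WithZero.exp_le_exp.2 (by omega))]
    · rw [max_eq_left h, min_eq_left (WithZero.exp_le_exp.2 (by omega))]
  have key : ∀ {A : Matrix (Fin n) (Fin n) (v.adicCompletion K)},
      IwahoriCond (Fin n) (WithZero.exp (-(b : ℤ)) : WithZero (Multiplicative ℤ)) (WithZero.exp (-(c : ℤ))) A →
      IwahoriCond (Fin n) (WithZero.exp (-(b' : ℤ)) : WithZero (Multiplicative ℤ)) (WithZero.exp (-(c' : ℤ))) A →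
      IwahoriCond (Fin n) (WithZero.exp (-((max b b' : ℕ) : ℤ)) : WithZero (Multiplicative ℤ))
        (WithZero.exp (-((max c c' : ℕ) : ℤ))) A := fun h₁ h₂ => by
    rw [hmin, hmin]
    exact ⟨h₁.le_one, fun i j hij => le_min (le_min ((h₁.lower i j hij).trans (min_le_left _ _))
        ((h₂.lower i j hij).trans (min_le_left _ _))) (le_min ((h₁.lower i j hij).trans (min_le_right _ _))
        ((h₂.lower i j hij).trans (min_le_right _ _))), fun i => le_min (h₁.diag i) (h₂.diag i)⟩
  rw [iwahoriLevel, mem_valuedIwahoriSubgroup_iff] at h h' ⊢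
  exact ⟨key h.1 h'.1, key h.2 h'.2⟩

end Iwahori

namespace TameLevel

open LevelAction

variable {K : Type} [Field K] [NumberField K] {p : ℕ} [Fact p.Prime] (𝒰 : TameLevel 2 K p)

/-! ### Indices and transversals of the levels `U(b, c)` -/

/-- **`U(b,c) ⊓ U(b',c') = U(max b b', max c c')`.** [folklore] -/
theorem level_inf_level (b c b' c' : ℕ) : 𝒰.level b c ⊓ 𝒰.level b' c' = 𝒰.level (max b b') (max c c') := by
  refine le_antisymm (fun x hx => ?_) (le_inf (𝒰.level_antitone (le_max_left _ _) (le_max_left _ _))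
    (𝒰.level_antitone (le_max_right _ _) (le_max_right _ _)))
  obtain ⟨h, h'⟩ := Subgroup.mem_inf.1 hx
  rw [𝒰.mem_level_iff] at h h' ⊢
  exact ⟨h.1, fun w hw => mem_iwahoriLevel_max w (h.2 w hw) (h'.2 w hw)⟩

/-- `[U(b',c') : U(b,c) ∩ U(b',c')]` is finite (compact/open). [folklore] -/
theorem relIndex_level_ne_zero (b c b' c' : ℕ) : (𝒰.level b c).relIndex (𝒰.level b' c') ≠ 0 := by
  haveI : CompactSpace (𝒰.level b' c') := isCompact_iff_compactSpace.1 (𝒰.isCompact_level b' c')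
  haveI : Finite (𝒰.level b' c' ⧸ (𝒰.level b c).subgroupOf (𝒰.level b' c')) :=
    Subgroup.quotient_finite_of_isOpen _ ((𝒰.isOpen_level b c).preimage continuous_subtype_val)
  exact Subgroup.index_ne_zero_of_finite

/-- **A transversal of `U(b',c') / U(b,c)`** exists (`U(b,c) ≤ U(b',c')` not even needed for the
statement). [folklore] -/
theorem exists_transversal_level (b c b' c' : ℕ) :
    ∃ S : Finset (FiniteAdelicGL 2 K), Set.BijOn (fun s : FiniteAdelicGL 2 K => (s : FiniteAdelicGL 2 K ⧸ 𝒰.level b c)) S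
      (ArithmeticQuotient.doubleCosetQuot₂ (𝒰.level b' c') (𝒰.level b c) 1) := by
  refine ArithmeticQuotient.exists_finset_bijOn_of_finite (Set.finite_of_ncard_ne_zero ?_)
  rw [ArithmeticQuotient.ncard_doubleCosetQuot₂_one]
  exact 𝒰.relIndex_level_ne_zero b c b' c'

/-- **Uniform index bound: `[U(r,c) : U(max r R, c)] ≤ [U(0,1) : U(R,R)]`** for `R ≤ c`, `1 ≤ c`.
[folklore] -/
theorem relIndex_level_le {R r c : ℕ} (hc : R ≤ c) (hc1 : 1 ≤ c) :
    (𝒰.level (max r R) c).relIndex (𝒰.level r c) ≤ (𝒰.level R R).relIndex (𝒰.level 0 1) := by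
  have h : 𝒰.level (max r R) c = 𝒰.level R R ⊓ 𝒰.level r c := by
    rw [𝒰.level_inf_level, max_comm, max_eq_right hc]
  rw [h, Subgroup.inf_relIndex_right]
  exact Subgroup.relIndex_le_of_le_right (𝒰.level_antitone (Nat.zero_le r) hc1) (𝒰.relIndex_level_ne_zero R R 0 1)

/-- The cardinality of a transversal is the index; a restatement of
`ArithmeticQuotient.card_eq_relIndex_of_bijOn` (use that directly). [folklore] -/
@[deprecated ArithmeticQuotient.card_eq_relIndex_of_bijOn (since := "2026-08-17")]
theorem card_transversal_level {b c b' c' : ℕ} {S : Finset (FiniteAdelicGL 2 K)}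
    (hS : Set.BijOn (fun s : FiniteAdelicGL 2 K => (s : FiniteAdelicGL 2 K ⧸ 𝒰.level b c)) S
      (ArithmeticQuotient.doubleCosetQuot₂ (𝒰.level b' c') (𝒰.level b c) 1)) :
    S.card = (𝒰.level b c).relIndex (𝒰.level b' c') :=
  ArithmeticQuotient.card_eq_relIndex_of_bijOn hS

/-! ### `N • H^q = 0` from a level with `H^q = 0` -/

/-- **`#S • y = 0` on `H^q(U', τ)` when `H^q(U, τ) = 0`** for `U ≤ U'` with transversal `S`
(`tr ∘ res = #S`). [cite: Hida1994AIF, §2] [cite: Brown1982CohomologyGroups, Ch. III, Prop. 9.5] -/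
theorem card_nsmul_eq_zero_of_subsingleton {R : Type} [CommRing R] {V : Type} [AddCommGroup V] [Module R V]
    (τ : (⊤ : Submonoid (FiniteAdelicGL 2 K)) →* Module.End R V) {U U' : Subgroup (FiniteAdelicGL 2 K)}
    (hle : U ≤ U') {S : Finset (FiniteAdelicGL 2 K)}
    (hS : Set.BijOn (fun s : FiniteAdelicGL 2 K => (s : FiniteAdelicGL 2 K ⧸ U)) S
      (ArithmeticQuotient.doubleCosetQuot₂ U' U 1)) (q : ℕ)
    [Subsingleton (cohomology (globalEmbedding 2 K) ⊤ τ U q)] (y : cohomology (globalEmbedding 2 K) ⊤ τ U' q) :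
    S.card • y = 0 := by
  have h := congrArg (fun f => (ModuleCat.Hom.hom f) y)
    (trCohomology_resCohomology (globalEmbedding 2 K) ⊤ τ (le_top : U.toSubmonoid ≤ ⊤) (le_top : U'.toSubmonoid ≤ ⊤) hle hS q)
  simp only [ModuleCat.hom_comp, LinearMap.coe_comp, Function.comp_apply, ModuleCat.hom_nsmul,
    ModuleCat.hom_id, LinearMap.smul_apply, LinearMap.id_apply] at h
  rw [Subsingleton.elim ((resCohomology (globalEmbedding 2 K) ⊤ τ hle q).hom y) 0, map_zero] at h
  exact h.symm

/-! ### `ker (res : H¹(U(r,c)) → H¹(U(c,c)))` is killed by `U_{v,1}^m` -/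

section Kernel

variable [Fact 𝒰.IsMaximalAbove] {v : HeightOneSpectrum (𝓞 K)}

/-- **`res x = 0 ⟹ U_{v,1}^m x = 0` on `H¹(U(r,c), ℤ/p^s)`** (`r ≤ c`, `1 ≤ c`, `m ≥ s`, `v ∣ p`):
flat-free finite-level control for `U(c,c) ⊴ U(r,c)` and the unipotent adapted family, with the
degree-zero input `U^m = 0` on `H⁰(𝓕 C)`. [cite: KhareThorne2017, §6.3, Prop. 6.6] [cite: Hida1994AIF, §3] -/
theorem laHecke_pow_apply_eq_zero_of_resCohomology_eq_zero (hv : (p : 𝓞 K) ∈ v.asIdeal) {r c : ℕ}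
    (hr : r ≤ c) (hc : 1 ≤ c) (s : ℕ) {m : ℕ} (hm : s ≤ m) (x : 𝒰.laCohomology ℤ r c s 1)
    (hx : (resCohomology (globalEmbedding 2 K) ⊤ (trivMod (K := K) (p := p) ℤ s)
      (𝒰.level_antitone hr le_rfl : 𝒰.level c c ≤ 𝒰.level r c) 1).hom x = 0) :
    (𝒰.laHecke ℤ r c s (heckeElement 2 K v 1) 1 ^ m) x = 0 := by
  classical
  have h𝒰 : 𝒰.IsMaximalAbove := Fact.out
  haveI := 𝒰.normal_subgroupOf_level h𝒰 hr hc
  haveI : Fintype (𝒰.level r c ⧸ (𝒰.level c c).subgroupOf (𝒰.level r c)) :=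
    @Fintype.ofFinite _ (𝒰.finite_quotient_level r c)
  have ha := 𝒰.isAdaptedFamily_unipotentFamily (v := v) h𝒰 hv hc hr hc (Δ := ⊤) fun _ => Submonoid.mem_top _
  have hbij := 𝒰.coe_unipotentFamily_bijOn' (v := v) h𝒰 hv (b' := r) (a := 1) hc
  have h₃ : ∀ y : groupCohomology (inducedRep (globalEmbedding 2 K) (trivMod (K := K) (p := p) ℤ s)
      (le_top : (𝒰.level r c).toSubmonoid ≤ ⊤) (QuotientGroup.mk' ((𝒰.level c c).subgroupOf (𝒰.level r c)))
      (cokerUnitRep ℤ (𝒰.level r c ⧸ (𝒰.level c c).subgroupOf (𝒰.level r c)))) 0,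
      (inducedHeckeCohomology (globalEmbedding 2 K) (trivMod (K := K) (p := p) ℤ s) le_top
        (QuotientGroup.mk' ((𝒰.level c c).subgroupOf (𝒰.level r c))) ha 0 ^ m) y = 0 := fun y =>
    LinearMap.congr_fun (𝒰.inducedHeckeCohomology_zero_pow_eq_zero_triv (cokerUnitRep ℤ _) h𝒰 hv hr hc
      (le_top : (𝒰.level r c).toSubmonoid ≤ ⊤) (fun _ => Submonoid.mem_top _) s hm) y
  have hker := ker_resCohomology_le_ker_pow_heckeCohomology (globalEmbedding 2 K)
    (trivMod (K := K) (p := p) ℤ s) (le_top : (𝒰.level c c).toSubmonoid ≤ ⊤)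
    (le_top : (𝒰.level r c).toSubmonoid ≤ ⊤) (𝒰.level_antitone hr le_rfl)
    (QuotientGroup.mk' ((𝒰.level c c).subgroupOf (𝒰.level r c)))
    (fun u => (𝒰.mem_level_iff_mk'_eq_one u).symm) Quotient.out (fun q => QuotientGroup.out_eq' q)
    (Submonoid.mem_top (heckeElement 2 K v 1 ^ 1)) ha hbij (zero_add 1) h₃
  have hx' := hker (LinearMap.mem_ker.2 hx)
  rw [LinearMap.mem_ker] at hx'
  have hcongr : 𝒰.laHecke ℤ r c s (heckeElement 2 K v 1) 1 =
      heckeCohomology (globalEmbedding 2 K) ⊤ (trivMod (K := K) (p := p) ℤ s) (𝒰.level r c) le_top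
        (Submonoid.mem_top (heckeElement 2 K v 1 ^ 1)) 1 :=
    heckeCohomology_congr (globalEmbedding 2 K) ⊤ _ (𝒰.level r c) le_top (Submonoid.mem_top _)
      (Submonoid.mem_top _) (pow_one (heckeElement 2 K v 1)).symm 1
  rw [hcongr]
  exact hx'

/-- Hence **`res : H¹(U(r,c)) → H¹(U(c,c))` is injective on `laOrd`** (finite cohomology).
[cite: Hida1994AIF, §3] -/
theorem eq_zero_of_resCohomology_eq_zero_of_mem_laOrd (hv : (p : 𝓞 K) ∈ v.asIdeal) {r c : ℕ}
    (hr : r ≤ c) (hc : 1 ≤ c) (s : ℕ) [Finite (𝒰.laCohomology ℤ r c s 1)]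
    {x : 𝒰.laCohomology ℤ r c s 1} (hxo : x ∈ 𝒰.laOrd ℤ r c s 1)
    (hx : (resCohomology (globalEmbedding 2 K) ⊤ (trivMod (K := K) (p := p) ℤ s)
      (𝒰.level_antitone hr le_rfl : 𝒰.level c c ≤ 𝒰.level r c) 1).hom x = 0) : x = 0 := by
  have h := 𝒰.laHecke_pow_apply_eq_zero_of_resCohomology_eq_zero hv hr hc s le_rfl x hx
  simp only [laOrd, Submodule.mem_iInf] at hxo
  exact eq_zero_of_pow_apply_eq_zero_of_mem_iInf _ ((Submodule.mem_iInf _).2 (hxo ⟨v, hv⟩)) h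

end Kernel

/-! ### Transport in degree one -/

section DegreeOne

variable [Fact 𝒰.IsMaximalAbove]

omit [Fact 𝒰.IsMaximalAbove] in
/-- `H^i(U(b,c), ℤ/p^s)` is finite, GIVEN Borel–Serre. [cite: BorelSerre1973, §11.1] -/
theorem finite_laCohomology (hX : BorelSerre1973_finite_groupCohomology_congruenceSubgroup) (b c s i : ℕ) :
    Finite (𝒰.laCohomology ℤ b c s i) := by
  haveI := finite_modPow_int p s
  exact finite_levelActionCohomology_level_of_borelSerre hX K p 𝒰 b c ⊤ le_top _ i

/-- **Transport in degree one: `LaKills c c c 1 z → LaKills r (max r 1) s 1 z`** (`r, s ≤ c`,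
`1 ≤ c`), GIVEN Borel–Serre. [cite: Hida1994AIF, §3, Thm 3.2] [cite: KhareThorne2017, §6.3] -/
theorem laKills_tower_one (hX : BorelSerre1973_finite_groupCohomology_congruenceSubgroup) {r c s : ℕ}
    (hc : 1 ≤ c) (hr : r ≤ c) (hs : s ≤ c) (z : MvPolynomial 𝒰.hidaElements ℤ) (hz : 𝒰.LaKills c c c 1 z) :
    𝒰.LaKills r (max r 1) s 1 z := by
  have h𝒰 : 𝒰.IsMaximalAbove := Fact.out
  have hr1 : max r 1 ≤ c := max_le hr hc
  obtain ⟨v, hv⟩ : ∃ v : HeightOneSpectrum (𝓞 K), (p : 𝓞 K) ∈ v.asIdeal := exists_mem_asIdeal_natCast p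
  haveI := fun b c s i => 𝒰.finite_laCohomology hX b c s i
  -- (1) along `res : H¹(U(r,c)) → H¹(U(c,c))`
  have h1 : 𝒰.LaKills r c c 1 z :=
    𝒰.laKills_of_injOn
      (resCohomology (globalEmbedding 2 K) ⊤ (trivMod (K := K) (p := p) ℤ c)
        (𝒰.level_antitone hr le_rfl : 𝒰.level c c ≤ 𝒰.level r c) 1).hom
      (fun g hg => 𝒰.resCohomology_comp_laHecke h𝒰 ℤ (𝒰.level_antitone hr le_rfl) hc hc c 1 hg)
      (fun x hxo hx0 => 𝒰.eq_zero_of_resCohomology_eq_zero_of_mem_laOrd hv hr hc c hxo hx0) z hz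
  -- (2) along `res : H¹(U(r, max r 1)) → H¹(U(r,c))` (Hida's lemma)
  have h2 : 𝒰.LaKills r (max r 1) c 1 z := by
    obtain ⟨hinj, -⟩ := 𝒰.injOn_resCohomology_laOrd h𝒰 hX (le_max_right r 1) (le_max_left r 1) hr1 c 1
    refine 𝒰.laKills_of_injOn
      (resCohomology (globalEmbedding 2 K) ⊤ (trivMod (K := K) (p := p) ℤ c)
        (𝒰.level_antitone le_rfl hr1 : 𝒰.level r c ≤ 𝒰.level r (max r 1)) 1).hom
      (fun g hg => 𝒰.resCohomology_comp_laHecke h𝒰 ℤ (𝒰.level_antitone le_rfl hr1) (le_max_right r 1) hc c 1 hg)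
      (fun x hxo hx0 => hinj hxo (Submodule.zero_mem _) (hx0.trans (map_zero _).symm)) z h1
  -- (3) along `(× p^{c-s})_* : H¹(ℤ/p^s) → H¹(ℤ/p^c)`
  rw [← Nat.add_sub_cancel' hs] at h2
  exact 𝒰.laKills_of_mul ⟨v, hv⟩ (𝒰.laHecke_zero_pow_eq_zero h𝒰 hv (le_max_left r 1) (le_max_right r 1)
    (c - s) le_rfl) z h2

end DegreeOne

/-! ### Transport in degree two -/

/-- Uniform index bound without `R ≤ c`: `[U(r,c) : U(max r R, max c R)] ≤ [U(0,1) : U(R,R)]`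
(`1 ≤ c`). [folklore] -/
theorem relIndex_level_max_le (R r : ℕ) {c : ℕ} (hc1 : 1 ≤ c) :
    (𝒰.level (max r R) (max c R)).relIndex (𝒰.level r c) ≤ (𝒰.level R R).relIndex (𝒰.level 0 1) := by
  have h : 𝒰.level (max r R) (max c R) = 𝒰.level R R ⊓ 𝒰.level r c := by
    rw [𝒰.level_inf_level, max_comm r, max_comm c]
  rw [h, Subgroup.inf_relIndex_right]
  exact Subgroup.relIndex_le_of_le_right (𝒰.level_antitone (Nat.zero_le r) hc1) (𝒰.relIndex_level_ne_zero R R 0 1)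

/-- **`[U(r,c') : W] • H³(U(r,c'), ℤ/p^a) = 0`** for the neat level `W = U(max r R, max c' R)`
(`R ≥ r₀`, `c' ≥ 1`), with `[U(r,c') : W] ≤ [U(0,1) : U(R,R)]`. [cite: Hida1994AIF, §1 (TF), §3] -/
theorem exists_nsmul_laCohomology_three_eq_zero
    (hcd : ∀ (W : Subgroup (FiniteAdelicGL 2 K)),
      IsOpen (W : Set (FiniteAdelicGL 2 K)) → IsCompact (W : Set (FiniteAdelicGL 2 K)) →
      (∀ γ ∈ W.comap (globalEmbedding 2 K), IsOfFinOrder γ → γ = 1) →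
      ∀ (A : Rep ℤ (W.comap (globalEmbedding 2 K))) (q : ℕ), 3 ≤ q → Subsingleton (groupCohomology A q))
    {r₀ : ℕ}
    (hr₀ : ∀ r : ℕ, r₀ ≤ r → ∀ (g : FiniteAdelicGL 2 K) (γ : GL (Fin 2) K), IsOfFinOrder γ →
      g⁻¹ * globalEmbedding 2 K γ * g ∈ 𝒰.hidaLevel r → γ = 1)
    (r : ℕ) {c' : ℕ} (hc' : 1 ≤ c') (a : ℕ) {q : ℕ} (hq : 3 ≤ q) :
    ∃ N : ℕ, 0 < N ∧ N ≤ (𝒰.level (max r₀ 1) (max r₀ 1)).relIndex (𝒰.level 0 1) ∧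
      ∀ w : 𝒰.laCohomology ℤ r c' a q, N • w = 0 := by
  set R := max r₀ 1 with hR
  have hle : 𝒰.level (max r R) (max c' R) ≤ 𝒰.level r c' := 𝒰.level_antitone (le_max_left _ _) (le_max_left _ _)
  obtain ⟨S, hS⟩ := 𝒰.exists_transversal_level (max r R) (max c' R) r c'
  haveI : Subsingleton (cohomology (globalEmbedding 2 K) ⊤ (trivMod (K := K) (p := p) ℤ a)
      (𝒰.level (max r R) (max c' R)) q) :=
    𝒰.subsingleton_levelActionCohomology_level_of_cd hcd hr₀ ((le_max_left _ _).trans (le_max_right _ _))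
      ((le_max_left _ _).trans (le_max_right _ _)) (hc'.trans (le_max_left _ _)) ⊤ le_top _ hq
  refine ⟨S.card, ?_, ?_, fun w => card_nsmul_eq_zero_of_subsingleton _ hle hS q w⟩
  · rw [ArithmeticQuotient.card_eq_relIndex_of_bijOn hS]
    exact Nat.pos_of_ne_zero (𝒰.relIndex_level_ne_zero _ _ _ _)
  · rw [ArithmeticQuotient.card_eq_relIndex_of_bijOn hS]
    exact 𝒰.relIndex_level_max_le R r hc'

section DegreeTwo

variable [Fact 𝒰.IsMaximalAbove]

/-- **The transfer `tr : H²(U(c,c), ℤ/p^s) → H²(U(r₁,c), ℤ/p^s)` is surjective at a neat level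
`r₁, c ≥ r₀`** (`r₁ ≤ c`, `1 ≤ c`): flat-free finite-level control (`range_trCohomology_eq_top`) with
`H³(𝓕 I_Q) = 0` from `cd ≤ 2`. [cite: KhareThorne2017, §6.3, Prop. 6.6] [cite: Hida1994AIF, §3] -/
theorem trCohomology_two_surjective
    (hcd : ∀ (W : Subgroup (FiniteAdelicGL 2 K)),
      IsOpen (W : Set (FiniteAdelicGL 2 K)) → IsCompact (W : Set (FiniteAdelicGL 2 K)) →
      (∀ γ ∈ W.comap (globalEmbedding 2 K), IsOfFinOrder γ → γ = 1) →
      ∀ (A : Rep ℤ (W.comap (globalEmbedding 2 K))) (q : ℕ), 3 ≤ q → Subsingleton (groupCohomology A q))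
    {r₀ : ℕ}
    (hr₀ : ∀ r : ℕ, r₀ ≤ r → ∀ (g : FiniteAdelicGL 2 K) (γ : GL (Fin 2) K), IsOfFinOrder γ →
      g⁻¹ * globalEmbedding 2 K γ * g ∈ 𝒰.hidaLevel r → γ = 1)
    {r₁ c : ℕ} (hr₁ : r₀ ≤ r₁) (hr₁c : r₁ ≤ c) (hc : 1 ≤ c) (s : ℕ) :
    Function.Surjective (trCohomology (globalEmbedding 2 K) ⊤ (trivMod (K := K) (p := p) ℤ s)
      (le_top : (𝒰.level c c).toSubmonoid ≤ ⊤) (le_top : (𝒰.level r₁ c).toSubmonoid ≤ ⊤) 2).hom := by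
  classical
  have h𝒰 : 𝒰.IsMaximalAbove := Fact.out
  haveI := 𝒰.normal_subgroupOf_level h𝒰 hr₁c hc
  haveI : Fintype (𝒰.level r₁ c ⧸ (𝒰.level c c).subgroupOf (𝒰.level r₁ c)) :=
    @Fintype.ofFinite _ (𝒰.finite_quotient_level r₁ c)
  haveI : Subsingleton (groupCohomology (inducedRep (globalEmbedding 2 K) (trivMod (K := K) (p := p) ℤ s)
      (le_top : (𝒰.level r₁ c).toSubmonoid ≤ ⊤) (QuotientGroup.mk' ((𝒰.level c c).subgroupOf (𝒰.level r₁ c)))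
      (augKerRep ℤ (𝒰.level r₁ c ⧸ (𝒰.level c c).subgroupOf (𝒰.level r₁ c)))) (2 + 1)) :=
    𝒰.subsingleton_levelActionCohomology_level_of_cd hcd hr₀ hr₁ (hr₁.trans hr₁c) hc
      (𝒰.level r₁ c).toSubmonoid le_rfl _ (by norm_num)
  have hrange := range_trCohomology_eq_top (globalEmbedding 2 K) (trivMod (K := K) (p := p) ℤ s)
    (le_top : (𝒰.level c c).toSubmonoid ≤ ⊤) (le_top : (𝒰.level r₁ c).toSubmonoid ≤ ⊤)
    (𝒰.level_antitone hr₁c le_rfl) (QuotientGroup.mk' ((𝒰.level c c).subgroupOf (𝒰.level r₁ c)))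
    (fun u => (𝒰.mem_level_iff_mk'_eq_one u).symm) Quotient.out (fun q => QuotientGroup.out_eq' q) 2
  exact LinearMap.range_eq_top.1 hrange

/-- **Transport in degree two: `LaKills c c c 2 z → LaKills r (max r 1) s 2 ((B₀²)! • z)`**
(`r, s ≤ c`, `max r₀ 1 ≤ c`) with the UNIFORM constant `B₀ = [U(0,1) : U(R,R)]`, `R = max r₀ 1`,
GIVEN Borel–Serre finiteness `hX`, `cd ≤ 2` at neat levels `hcd` and the neatness threshold `hr₀`.
[cite: Hida1994AIF, §3, Thm 3.2] [cite: KhareThorne2017, §6.3] -/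
theorem laKills_tower_two (hX : BorelSerre1973_finite_groupCohomology_congruenceSubgroup)
    (hcd : ∀ (W : Subgroup (FiniteAdelicGL 2 K)),
      IsOpen (W : Set (FiniteAdelicGL 2 K)) → IsCompact (W : Set (FiniteAdelicGL 2 K)) →
      (∀ γ ∈ W.comap (globalEmbedding 2 K), IsOfFinOrder γ → γ = 1) →
      ∀ (A : Rep ℤ (W.comap (globalEmbedding 2 K))) (q : ℕ), 3 ≤ q → Subsingleton (groupCohomology A q))
    {r₀ : ℕ}
    (hr₀ : ∀ r : ℕ, r₀ ≤ r → ∀ (g : FiniteAdelicGL 2 K) (γ : GL (Fin 2) K), IsOfFinOrder γ →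
      g⁻¹ * globalEmbedding 2 K γ * g ∈ 𝒰.hidaLevel r → γ = 1)
    {r c s : ℕ} (hRc : max r₀ 1 ≤ c) (hr : r ≤ c) (hs : s ≤ c)
    (z : MvPolynomial 𝒰.hidaElements ℤ) (hz : 𝒰.LaKills c c c 2 z) :
    𝒰.LaKills r (max r 1) s 2
      (MvPolynomial.C ((((𝒰.level (max r₀ 1) (max r₀ 1)).relIndex (𝒰.level 0 1)) ^ 2).factorial : ℤ) * z) := by
  have h𝒰 : 𝒰.IsMaximalAbove := Fact.out
  set R := max r₀ 1 with hR
  set B₀ := (𝒰.level R R).relIndex (𝒰.level 0 1) with hB₀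
  have hc : 1 ≤ c := (le_max_right r₀ 1).trans hRc
  have hr1 : max r 1 ≤ c := max_le hr hc
  have hr₁c : max r R ≤ c := max_le hr hRc
  have hr₀r₁ : r₀ ≤ max r R := (le_max_left r₀ 1).trans (le_max_right _ _)
  haveI := fun b c s i => 𝒰.finite_laCohomology hX b c s i
  -- (1) along the surjective `tr : H²(U(c,c)) → H²(U(max r R, c))`
  have h1 : 𝒰.LaKills (max r R) c c 2 z := by
    have h := 𝒰.laKills_mul_C_of_surjOn
      (trCohomology (globalEmbedding 2 K) ⊤ (trivMod (K := K) (p := p) ℤ c)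
        (le_top : (𝒰.level c c).toSubmonoid ≤ ⊤) (le_top : (𝒰.level (max r R) c).toSubmonoid ≤ ⊤) 2).hom
      (fun g hg => 𝒰.trCohomology_comp_laHecke h𝒰 ℤ hr₁c le_rfl hc c 2 hg)
      (fun y hy => 𝒰.exists_mem_laOrd_map_eq_nsmul _
        (fun g hg => 𝒰.trCohomology_comp_laHecke h𝒰 ℤ hr₁c le_rfl hc c 2 hg) (N := 1)
        (fun y => by
          obtain ⟨x, hx⟩ := 𝒰.trCohomology_two_surjective hcd hr₀ hr₀r₁ hr₁c hc c y
          exact ⟨x, by rw [hx, one_nsmul]⟩) hy) z hz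
    simpa only [Nat.cast_one, map_one, one_mul] using h
  -- (2) along `tr : H²(U(max r R, c)) → H²(U(r, c))`, surjective up to `N' = [U(r,c) : U(max r R, c)]`
  obtain ⟨S', hS'⟩ := 𝒰.exists_transversal_level (max r R) c r c
  have hle' : 𝒰.level (max r R) c ≤ 𝒰.level r c := 𝒰.level_antitone (le_max_left _ _) le_rfl
  have h2 : 𝒰.LaKills r c c 2 (MvPolynomial.C (S'.card : ℤ) * z) :=
    𝒰.laKills_mul_C_of_surjOn
      (trCohomology (globalEmbedding 2 K) ⊤ (trivMod (K := K) (p := p) ℤ c)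
        (le_top : (𝒰.level (max r R) c).toSubmonoid ≤ ⊤) (le_top : (𝒰.level r c).toSubmonoid ≤ ⊤) 2).hom
      (fun g hg => 𝒰.trCohomology_comp_laHecke h𝒰 ℤ (le_max_left r R) hr₁c hc c 2 hg)
      (fun y hy => 𝒰.exists_mem_laOrd_map_eq_nsmul _
        (fun g hg => 𝒰.trCohomology_comp_laHecke h𝒰 ℤ (le_max_left r R) hr₁c hc c 2 hg)
        (fun y => ⟨(resCohomology (globalEmbedding 2 K) ⊤ (trivMod (K := K) (p := p) ℤ c) hle' 2).hom y, by
          have h := congrArg (fun f => (ModuleCat.Hom.hom f) y)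
            (trCohomology_resCohomology (globalEmbedding 2 K) ⊤ (trivMod (K := K) (p := p) ℤ c)
              (le_top : (𝒰.level (max r R) c).toSubmonoid ≤ ⊤) (le_top : (𝒰.level r c).toSubmonoid ≤ ⊤)
              hle' hS' 2)
          simpa only [ModuleCat.hom_comp, LinearMap.coe_comp, Function.comp_apply, ModuleCat.hom_nsmul,
            ModuleCat.hom_id, LinearMap.smul_apply, LinearMap.id_apply] using h⟩) hy) z h1
  -- (3) along `res : H²(U(r, max r 1)) → H²(U(r,c))` (Hida's lemma)
  have h3 : 𝒰.LaKills r (max r 1) c 2 (MvPolynomial.C (S'.card : ℤ) * z) := by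
    obtain ⟨hinj, -⟩ := 𝒰.injOn_resCohomology_laOrd h𝒰 hX (le_max_right r 1) (le_max_left r 1) hr1 c 2
    exact 𝒰.laKills_of_injOn
      (resCohomology (globalEmbedding 2 K) ⊤ (trivMod (K := K) (p := p) ℤ c)
        (𝒰.level_antitone le_rfl hr1 : 𝒰.level r c ≤ 𝒰.level r (max r 1)) 2).hom
      (fun g hg => 𝒰.resCohomology_comp_laHecke h𝒰 ℤ (𝒰.level_antitone le_rfl hr1) (le_max_right r 1) hc c 2 hg)
      (fun x hxo hx0 => hinj hxo (Submodule.zero_mem _) (hx0.trans (map_zero _).symm)) _ h2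
  -- (4) along the reduction `H²(ℤ/p^c) → H²(ℤ/p^s)`, surjective up to `N₀` with `N₀ • H³(ℤ/p^{c-s}) = 0`
  obtain ⟨N₀, hN₀, hN₀le, hN₀kill⟩ := 𝒰.exists_nsmul_laCohomology_three_eq_zero hcd hr₀ r
    (le_max_right r 1) (c - s) (le_refl 3)
  rw [← Nat.sub_add_cancel hs] at h3
  have h4 := 𝒰.laKills_mul_C_of_red hN₀kill _ h3
  rw [← mul_assoc, ← map_mul, ← Nat.cast_mul] at h4
  -- (5) replace `N₀ N'` by the uniform `(B₀²)!`
  refine 𝒰.laKills_mul_C_of_dvd (Nat.dvd_factorial (Nat.mul_pos hN₀ ?_) ?_) z h4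
  · rw [ArithmeticQuotient.card_eq_relIndex_of_bijOn hS']
    exact Nat.pos_of_ne_zero (𝒰.relIndex_level_ne_zero _ _ _ _)
  · rw [ArithmeticQuotient.card_eq_relIndex_of_bijOn hS', pow_two]
    refine Nat.mul_le_mul hN₀le ?_
    have h := 𝒰.relIndex_level_max_le R r hc
    rwa [max_eq_left hRc] at h

end DegreeTwo



/-! ### Arbitrary coefficient depth `c'` at the source level `U(c,c)` -/

section Depth

variable [Fact 𝒰.IsMaximalAbove]

/-- **Transport in degree one, coefficient depth `c'`: `LaKills c c c' 1 z → LaKills r (max r 1) s 1 z`**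
(`r ≤ c`, `s ≤ c'`, `1 ≤ c`), GIVEN Borel–Serre. [cite: Hida1994AIF, §3, Thm 3.2] [cite: KhareThorne2017, §6.3] -/
theorem laKills_tower_one' (hX : BorelSerre1973_finite_groupCohomology_congruenceSubgroup) {r c c' s : ℕ}
    (hc : 1 ≤ c) (hr : r ≤ c) (hs : s ≤ c') (z : MvPolynomial 𝒰.hidaElements ℤ) (hz : 𝒰.LaKills c c c' 1 z) :
    𝒰.LaKills r (max r 1) s 1 z := by
  have h𝒰 : 𝒰.IsMaximalAbove := Fact.out
  have hr1 : max r 1 ≤ c := max_le hr hc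
  obtain ⟨v, hv⟩ : ∃ v : HeightOneSpectrum (𝓞 K), (p : 𝓞 K) ∈ v.asIdeal := exists_mem_asIdeal_natCast p
  haveI := fun b c s i => 𝒰.finite_laCohomology hX b c s i
  -- (1) along `res : H¹(U(r,c)) → H¹(U(c,c))`
  have h1 : 𝒰.LaKills r c c' 1 z :=
    𝒰.laKills_of_injOn
      (resCohomology (globalEmbedding 2 K) ⊤ (trivMod (K := K) (p := p) ℤ c')
        (𝒰.level_antitone hr le_rfl : 𝒰.level c c ≤ 𝒰.level r c) 1).hom
      (fun g hg => 𝒰.resCohomology_comp_laHecke h𝒰 ℤ (𝒰.level_antitone hr le_rfl) hc hc c' 1 hg)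
      (fun x hxo hx0 => 𝒰.eq_zero_of_resCohomology_eq_zero_of_mem_laOrd hv hr hc c' hxo hx0) z hz
  -- (2) along `res : H¹(U(r, max r 1)) → H¹(U(r,c))` (Hida's lemma)
  have h2 : 𝒰.LaKills r (max r 1) c' 1 z := by
    obtain ⟨hinj, -⟩ := 𝒰.injOn_resCohomology_laOrd h𝒰 hX (le_max_right r 1) (le_max_left r 1) hr1 c' 1
    refine 𝒰.laKills_of_injOn
      (resCohomology (globalEmbedding 2 K) ⊤ (trivMod (K := K) (p := p) ℤ c')
        (𝒰.level_antitone le_rfl hr1 : 𝒰.level r c ≤ 𝒰.level r (max r 1)) 1).hom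
      (fun g hg => 𝒰.resCohomology_comp_laHecke h𝒰 ℤ (𝒰.level_antitone le_rfl hr1) (le_max_right r 1) hc c' 1 hg)
      (fun x hxo hx0 => hinj hxo (Submodule.zero_mem _) (hx0.trans (map_zero _).symm)) z h1
  -- (3) along `(× p^{c'-s})_* : H¹(ℤ/p^s) → H¹(ℤ/p^{c'})`
  rw [← Nat.add_sub_cancel' hs] at h2
  exact 𝒰.laKills_of_mul ⟨v, hv⟩ (𝒰.laHecke_zero_pow_eq_zero h𝒰 hv (le_max_left r 1) (le_max_right r 1)
    (c' - s) le_rfl) z h2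


/-- **Transport in degree two, coefficient depth `c'`: `LaKills c c c' 2 z → LaKills r (max r 1) s 2 ((B₀²)! • z)`**
(`r ≤ c`, `s ≤ c'`, `max r₀ 1 ≤ c`), uniform `B₀ = [U(0,1) : U(R,R)]`.
[cite: Hida1994AIF, §3, Thm 3.2] [cite: KhareThorne2017, §6.3] -/
theorem laKills_tower_two' (hX : BorelSerre1973_finite_groupCohomology_congruenceSubgroup)
    (hcd : ∀ (W : Subgroup (FiniteAdelicGL 2 K)),
      IsOpen (W : Set (FiniteAdelicGL 2 K)) → IsCompact (W : Set (FiniteAdelicGL 2 K)) →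
      (∀ γ ∈ W.comap (globalEmbedding 2 K), IsOfFinOrder γ → γ = 1) →
      ∀ (A : Rep ℤ (W.comap (globalEmbedding 2 K))) (q : ℕ), 3 ≤ q → Subsingleton (groupCohomology A q))
    {r₀ : ℕ}
    (hr₀ : ∀ r : ℕ, r₀ ≤ r → ∀ (g : FiniteAdelicGL 2 K) (γ : GL (Fin 2) K), IsOfFinOrder γ →
      g⁻¹ * globalEmbedding 2 K γ * g ∈ 𝒰.hidaLevel r → γ = 1)
    {r c c' s : ℕ} (hRc : max r₀ 1 ≤ c) (hr : r ≤ c) (hs : s ≤ c')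
    (z : MvPolynomial 𝒰.hidaElements ℤ) (hz : 𝒰.LaKills c c c' 2 z) :
    𝒰.LaKills r (max r 1) s 2
      (MvPolynomial.C ((((𝒰.level (max r₀ 1) (max r₀ 1)).relIndex (𝒰.level 0 1)) ^ 2).factorial : ℤ) * z) := by
  have h𝒰 : 𝒰.IsMaximalAbove := Fact.out
  set R := max r₀ 1 with hR
  set B₀ := (𝒰.level R R).relIndex (𝒰.level 0 1) with hB₀
  have hc : 1 ≤ c := (le_max_right r₀ 1).trans hRc
  have hr1 : max r 1 ≤ c := max_le hr hc
  have hr₁c : max r R ≤ c := max_le hr hRc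
  have hr₀r₁ : r₀ ≤ max r R := (le_max_left r₀ 1).trans (le_max_right _ _)
  haveI := fun b c s i => 𝒰.finite_laCohomology hX b c s i
  -- (1) along the surjective `tr : H²(U(c,c)) → H²(U(max r R, c))`
  have h1 : 𝒰.LaKills (max r R) c c' 2 z := by
    have h := 𝒰.laKills_mul_C_of_surjOn
      (trCohomology (globalEmbedding 2 K) ⊤ (trivMod (K := K) (p := p) ℤ c')
        (le_top : (𝒰.level c c).toSubmonoid ≤ ⊤) (le_top : (𝒰.level (max r R) c).toSubmonoid ≤ ⊤) 2).hom
      (fun g hg => 𝒰.trCohomology_comp_laHecke h𝒰 ℤ hr₁c le_rfl hc c' 2 hg)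
      (fun y hy => 𝒰.exists_mem_laOrd_map_eq_nsmul _
        (fun g hg => 𝒰.trCohomology_comp_laHecke h𝒰 ℤ hr₁c le_rfl hc c' 2 hg) (N := 1)
        (fun y => by
          obtain ⟨x, hx⟩ := 𝒰.trCohomology_two_surjective hcd hr₀ hr₀r₁ hr₁c hc c' y
          exact ⟨x, by rw [hx, one_nsmul]⟩) hy) z hz
    simpa only [Nat.cast_one, map_one, one_mul] using h
  -- (2) along `tr : H²(U(max r R, c)) → H²(U(r, c))`, surjective up to `N' = [U(r,c) : U(max r R, c)]`
  obtain ⟨S', hS'⟩ := 𝒰.exists_transversal_level (max r R) c r c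
  have hle' : 𝒰.level (max r R) c ≤ 𝒰.level r c := 𝒰.level_antitone (le_max_left _ _) le_rfl
  have h2 : 𝒰.LaKills r c c' 2 (MvPolynomial.C (S'.card : ℤ) * z) :=
    𝒰.laKills_mul_C_of_surjOn
      (trCohomology (globalEmbedding 2 K) ⊤ (trivMod (K := K) (p := p) ℤ c')
        (le_top : (𝒰.level (max r R) c).toSubmonoid ≤ ⊤) (le_top : (𝒰.level r c).toSubmonoid ≤ ⊤) 2).hom
      (fun g hg => 𝒰.trCohomology_comp_laHecke h𝒰 ℤ (le_max_left r R) hr₁c hc c' 2 hg)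
      (fun y hy => 𝒰.exists_mem_laOrd_map_eq_nsmul _
        (fun g hg => 𝒰.trCohomology_comp_laHecke h𝒰 ℤ (le_max_left r R) hr₁c hc c' 2 hg)
        (fun y => ⟨(resCohomology (globalEmbedding 2 K) ⊤ (trivMod (K := K) (p := p) ℤ c') hle' 2).hom y, by
          have h := congrArg (fun f => (ModuleCat.Hom.hom f) y)
            (trCohomology_resCohomology (globalEmbedding 2 K) ⊤ (trivMod (K := K) (p := p) ℤ c')
              (le_top : (𝒰.level (max r R) c).toSubmonoid ≤ ⊤) (le_top : (𝒰.level r c).toSubmonoid ≤ ⊤)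
              hle' hS' 2)
          simpa only [ModuleCat.hom_comp, LinearMap.coe_comp, Function.comp_apply, ModuleCat.hom_nsmul,
            ModuleCat.hom_id, LinearMap.smul_apply, LinearMap.id_apply] using h⟩) hy) z h1
  -- (3) along `res : H²(U(r, max r 1)) → H²(U(r,c))` (Hida's lemma)
  have h3 : 𝒰.LaKills r (max r 1) c' 2 (MvPolynomial.C (S'.card : ℤ) * z) := by
    obtain ⟨hinj, -⟩ := 𝒰.injOn_resCohomology_laOrd h𝒰 hX (le_max_right r 1) (le_max_left r 1) hr1 c' 2
    exact 𝒰.laKills_of_injOn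
      (resCohomology (globalEmbedding 2 K) ⊤ (trivMod (K := K) (p := p) ℤ c')
        (𝒰.level_antitone le_rfl hr1 : 𝒰.level r c ≤ 𝒰.level r (max r 1)) 2).hom
      (fun g hg => 𝒰.resCohomology_comp_laHecke h𝒰 ℤ (𝒰.level_antitone le_rfl hr1) (le_max_right r 1) hc c' 2 hg)
      (fun x hxo hx0 => hinj hxo (Submodule.zero_mem _) (hx0.trans (map_zero _).symm)) _ h2
  -- (4) along the reduction `H²(ℤ/p^c) → H²(ℤ/p^s)`, surjective up to `N₀` with `N₀ • H³(ℤ/p^{c-s}) = 0`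
  obtain ⟨N₀, hN₀, hN₀le, hN₀kill⟩ := 𝒰.exists_nsmul_laCohomology_three_eq_zero hcd hr₀ r
    (le_max_right r 1) (c' - s) (le_refl 3)
  rw [← Nat.sub_add_cancel hs] at h3
  have h4 := 𝒰.laKills_mul_C_of_red hN₀kill _ h3
  rw [← mul_assoc, ← map_mul, ← Nat.cast_mul] at h4
  -- (5) replace `N₀ N'` by the uniform `(B₀²)!`
  refine 𝒰.laKills_mul_C_of_dvd (Nat.dvd_factorial (Nat.mul_pos hN₀ ?_) ?_) z h4
  · rw [ArithmeticQuotient.card_eq_relIndex_of_bijOn hS']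
    exact Nat.pos_of_ne_zero (𝒰.relIndex_level_ne_zero _ _ _ _)
  · rw [ArithmeticQuotient.card_eq_relIndex_of_bijOn hS', pow_two]
    refine Nat.mul_le_mul hN₀le ?_
    have h := 𝒰.relIndex_level_max_le R r hc
    rwa [max_eq_left hRc] at h


end Depth

end TameLevel

end BigHeckeGLn

end Literature.NumberTheory.Automorphic
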